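import Literature.NumberTheory.EllipticCurves.SelmerTorsionRestriction
import Literature.NumberTheory.EllipticCurves.SelmerPInftyRelModelAction
import Literature.NumberTheory.EllipticCurves.SelmerRestrictionCorank
import HarnessLib

/-!
# The `Gal(L/K)`-action on `H¹(L, E_L[n])` in the subgroup model, for `E/K` and `L/K` Galois
# (finite level): restricted classes are invariant, the kernel is killed by `[L : K]`, invariants are
# restrictions up to `[L : K]`, and `res` is injective when `E[n]^{Γ_L} = 0`

The FINITE-LEVEL relative companion of `Literature.NumberTheory.EllipticCurves.SelmerPInftyRelModelAction`
(`E[p^∞]`-coefficients, relative) and of the `Quadratic` section of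
`Literature.NumberTheory.EllipticCurves.SelmerTorsionRestriction` (`E[n]`-coefficients, but `E/ℚ` and
`K/ℚ` quadratic only). For a Weierstrass curve `E = W` over a number field `K`, a finite **Galois**
extension `L/K` of number fields, `σ₀ ∈ Gal(L/K)` and `n : ℤ`, on the tree's models
`H¹(K, E[n]) = galH1Torsion W n`, `H¹(L, E_L[n]) = galH1Torsion (W.baseChange L) n`, restriction
`resTorsion W L n`, the action `conjAct W σ₀ n` of `σ₀` on `H¹(L, E_L[n])` (file `SelmerGaloisAction`,
built for any base) and the subgroup model `modelIsoTorsion L W n : H¹(L, E_L[n]) ≃ H¹(galRange L, E[n])`: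

* `RelModel.torsionBaseChangeEquiv_smul_liftToAbsGal` — the coefficient sides of the two compatible
  pairs agree (`τ₀ (ι P) = ι (c₀ • P)`, `c₀ = liftToAbsGal L σ₀` the transported lift);
* `RelModel.modelIsoTorsion_conjAct` — **the action in the subgroup model**:
  `modelIsoTorsion (σ₀ · s) = (c₀)_* (modelIsoTorsion s)` (verbatim the argument of
  `modelIsoTorsion_conjAct`, with `ℚ` replaced by `K`: `RelModel.resGal_conjGalCMH`,
  `RelModel.normal_galRange`);
* `RelModel.conjAct_resTorsion` — **restricted classes are `Gal(L/K)`-invariant**: `σ₀ · res x = res x`;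
* `RelModel.finrank_nsmul_eq_zero_of_resTorsion_eq_zero` — the kernel of `res` is killed by `[L : K]`
  (`cor ∘ res`, `RelModel.index_galRange`);
* `RelModel.exists_resTorsion_eq_finrank_nsmul_of_forall_conjAct_eq` — a class fixed by every
  `σ ∈ Gal(L/K)` is, after multiplication by `[L : K]`, a restriction (`res ∘ cor`; the transported lifts
  are coset representatives, `RelModel.exists_liftToAbsGal_inv_mul_mem_galRange`);
* `inflClass_eq_zero_of_fixedPoints_eq_bot` (generic: a crossed homomorphism vanishing on a NORMAL
  subgroup `N` takes values in `M^N`) and **`RelModel.resTorsion_injective_of_fixedPoints_eq_bot`** —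
  inflation–restriction: `res : H¹(K, E[n]) → H¹(L, E_L[n])` is injective as soon as no non-zero point of
  `E[n]` is fixed by `galRange L` (`E_L[n](L) = 0`), the kernel being inflated
  (`resKer_le_range_inflClass`);
* `RelModel.forall_conjAct_eq_iff_of_finrank_eq_two` — for `[L : K] = 2` and `σ₀ ≠ 1`, invariance under
  `Gal(L/K)` is invariance under `σ₀`.

This is the bookkeeping of Dokchitser–Dokchitser, Ann. of Math. 172 (2010), proof of Lemma 4.14
("the restriction map from `H¹(K, E[pⁿ])` to `H¹(F, E[pⁿ])^G` … kernel and cokernel killed by `|G|²`")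
for `E` over a number field `K` and `F/K` Galois, at finite level, together with the sharp injectivity
of inflation–restriction (Serre, *Galois Cohomology*, I.§2.6 (b)). Everything here is proved; no named
fact, no definition is introduced. Declarations are grouped in the sub-namespace `RelModel`, the
unprefixed names being those of the `ℚ`/quadratic case.

## References

* T. Dokchitser, V. Dokchitser, Ann. of Math. 172 (2010), Lemma 4.14 (proof), Cor. 4.15.
  [DokchitserDokchitserAnnals2010]
* J.-P. Serre, *Galois Cohomology* (1997), I.§2.4–2.6, I.§5.8, II.§1.1. [SerreGaloisCohomology1997]
* J.-P. Serre, *Local Fields* (1979), VII.§5, Prop. 3. [SerreLocalFields1979]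
-/

noncomputable section

open scoped Classical

universe u

namespace Literature.NumberTheory.EllipticCurves

open GaloisRepresentations WeierstrassCurve

/-! ## Generic: inflated classes vanish when `M^N = 0` -/

section Inflation

variable {G : Type u} [Group G] [TopologicalSpace G] [IsTopologicalGroup G]
variable {M : Type u} [AddCommGroup M] [DistribMulAction G M] [TopologicalSpace M]
  [DiscreteTopology M]

/-- A crossed homomorphism vanishing on a NORMAL subgroup `N` takes `N`-invariant values
(`cocyclesVanishingOn.smul_apply`); so if `M^N = 0` it is zero and so is its inflated class.
Serre, *Galois Cohomology*, I.§5.8 (inflation–restriction: `H¹(G/N, M^N) = 0` when `M^N = 0`).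
[cite: SerreGaloisCohomology1997, I.§2.6 (b)] -/
theorem inflClass_eq_zero_of_fixedPoints_eq_bot (N : Subgroup G) [N.Normal] (hN : IsOpen (N : Set G))
    (hfix : FixedPoints.addSubgroup N M = ⊥) (f : cocyclesVanishingOn M N) :
    inflClass M N hN f = 0 := by
  have hf : f = 0 := by
    apply Subtype.ext
    funext g
    have hmem : f.1 g ∈ FixedPoints.addSubgroup N M :=
      (FixedPoints.mem_addSubgroup _ _ _).2 fun m ↦ by
        rw [Subgroup.smul_def]
        exact cocyclesVanishingOn.smul_apply f g m.2
    rw [hfix, AddSubgroup.mem_bot] at hmem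
    exact hmem
  rw [hf, map_zero]

end Inflation

namespace RelModel

/-! ## The action of `Gal(L/K)` on `H¹(L, E_L[n])` in the subgroup model -/

section Action

variable {K : Type u} [Field K] [NumberField K] (L : Type u) [Field L] [NumberField L]
  [Algebra K L] (W : WeierstrassCurve K) (n : ℤ) (σ₀ : L ≃ₐ[K] L)

variable {L} in
/-- The coefficient sides agree on `E[n]`: `τ₀ (ι P) = ι (c₀ • P)` for the coefficient isomorphism
`ι = torsionBaseChangeEquiv`, the lift `τ₀ = liftAut σ₀` acting on `E_L[n](L̄)` (`IsLiftOfAut.torsionMap`)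
and the transported lift `c₀ = liftToAbsGal L σ₀ ∈ Γ_K` (from
`RelModel.localPointsEquivGeomPoints_pointsMap_smul`). [cite: SerreGaloisCohomology1997, I.§2.5] -/
theorem torsionBaseChangeEquiv_smul_liftToAbsGal [Algebra.IsAlgebraic K L] (P : geomTorsion W n) :
    (isLiftOfAut_liftAut σ₀).torsionMap W n (torsionBaseChangeEquiv L W n P) =
      torsionBaseChangeEquiv L W n (liftToAbsGal (K := K) L σ₀ • P) := by
  apply Subtype.ext
  rw [IsLiftOfAut.coe_torsionMap, torsionBaseChangeEquiv_apply, torsionBaseChangeEquiv_apply,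
    coe_torsionBaseChangeMap, coe_torsionBaseChangeMap, AddSubgroup.torsionBy.coe_smul]
  exact (RelModel.localPointsEquivGeomPoints_pointsMap_smul W σ₀ _).symm

variable [IsGalois K L]

/-- **The action of `Gal(L/K)` in the subgroup model, finite level.** For `L/K` finite Galois and
`σ₀ ∈ Gal(L/K)`: `modelIsoTorsion (σ₀ · s) = (c₀)_* (modelIsoTorsion s)`, where `σ₀ · s = conjAct W σ₀ n s`
is the action of `σ₀` on `H¹(L, E_L[n])` (`E = W/K`) and `(c₀)_* = conjH1 … (liftToAbsGal L σ₀)` is the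
conjugation action on `H¹(galRange L, E[n])` (normal subgroup by `RelModel.normal_galRange`). Both are
maps of compatible pairs `Γ_L ⇉ galRange L`, `E_L[n] ⇉ E[n]`, which agree on the nose
(`RelModel.resGal_conjGalCMH`, `torsionBaseChangeEquiv_smul_liftToAbsGal`). (The tree's
`modelIsoTorsion_conjAct` is the case `K = ℚ`, `[L : K] = 2`; `RelModel.modelIso_relConjH1Primary` is the
`E[p^∞]` twin.) [cite: DokchitserDokchitserAnnals2010, Lemma 4.14 (proof)]
[cite: SerreGaloisCohomology1997, I.§2.5] -/
theorem modelIsoTorsion_conjAct (s : galH1Torsion (W.baseChange L) n) :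
    haveI := RelModel.normal_galRange (K := K) L
    modelIsoTorsion L W n (conjAct W σ₀ n s) =
      conjH1 (galRange (K := K) L) (geomTorsion W n) (liftToAbsGal (K := K) L σ₀)
        (modelIsoTorsion L W n s) := by
  haveI := RelModel.normal_galRange (K := K) L
  have hG : ((isLiftOfAut_liftAut σ₀).conjGalCMH).comp (rangeToResGal (K := K) L) =
      (rangeToResGal (K := K) L).comp
        (subgroupConj (galRange (K := K) L) (liftToAbsGal (K := K) L σ₀)) := by
    apply ContinuousMonoidHom.ext
    intro g
    apply resGal_injective (K := K) L
    change resGal (K := K) L ((isLiftOfAut_liftAut σ₀).conjGalCMH (rangeToResGal (K := K) L g)) =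
      resGal (K := K) L (rangeToResGal (K := K) L
        (subgroupConj (galRange (K := K) L) (liftToAbsGal (K := K) L σ₀) g))
    rw [RelModel.resGal_conjGalCMH, resGal_rangeToResGal, resGal_rangeToResGal, subgroupConj_apply_coe]
  have hM : ((torsionBaseChangeEquiv L W n).symm.toAddMonoidHom).comp
        ((isLiftOfAut_liftAut σ₀).torsionMap W n) =
      (DistribSMul.toAddMonoidHom (geomTorsion W n) (liftToAbsGal (K := K) L σ₀)).comp
        (torsionBaseChangeEquiv L W n).symm.toAddMonoidHom := by
    refine AddMonoidHom.ext fun m ↦ ?_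
    apply (torsionBaseChangeEquiv L W n).injective
    change torsionBaseChangeEquiv L W n ((torsionBaseChangeEquiv L W n).symm
        ((isLiftOfAut_liftAut σ₀).torsionMap W n m)) =
      torsionBaseChangeEquiv L W n (liftToAbsGal (K := K) L σ₀ • (torsionBaseChangeEquiv L W n).symm m)
    rw [AddEquiv.apply_symm_apply, ← torsionBaseChangeEquiv_smul_liftToAbsGal,
      AddEquiv.apply_symm_apply]
  have hconj : conjAct W σ₀ n = resH1Hom (isLiftOfAut_liftAut σ₀).conjGalCMH
      ((isLiftOfAut_liftAut σ₀).torsionMap W n) ((isLiftOfAut_liftAut σ₀).torsionMap_smul W n) :=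
    rfl
  rw [modelIsoTorsion_apply, modelIsoTorsion_apply, hconj, conjH1, resH1Hom_resH1Hom,
    resH1Hom_resH1Hom]
  exact congrFun (congrArg DFunLike.coe (resH1Hom_congr hG hM _ _)) s

/-- **Restricted classes are `Gal(L/K)`-invariant**: `σ₀ · res x = res x` in `H¹(L, E_L[n])` for every
`x ∈ H¹(K, E[n])` and `σ₀ ∈ Gal(L/K)`, `L/K` finite Galois (in the subgroup model `res x` is the
restriction to the normal subgroup `galRange L`, fixed by every conjugation: `conjH1_resSubgroupH1_eq`).
This is "the restriction map from `H¹(K, E[pⁿ])` to `H¹(F, E[pⁿ])^G`" of Dokchitser–Dokchitser 2010,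
proof of Lemma 4.14 (its image lies in the `G`-invariants). (The tree's `conjAct_resTorsion` is the case
`K = ℚ`, `[L : K] = 2`.) [cite: DokchitserDokchitserAnnals2010, Lemma 4.14 (proof)]
[cite: SerreLocalFields1979, VII.§5 Prop. 3] -/
theorem conjAct_resTorsion (x : galH1Torsion W n) :
    conjAct W σ₀ n (resTorsion W L n x) = resTorsion W L n x := by
  haveI := RelModel.normal_galRange (K := K) L
  apply (modelIsoTorsion L W n).injective
  rw [modelIsoTorsion_conjAct L W n σ₀, modelIsoTorsion_resTorsion, conjH1_resSubgroupH1_eq]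

omit [IsGalois K L] in
/-- For `[L : K] = 2` with `σ₀ ≠ 1`, every element of `Aut(L/K)` is `1` or `σ₀`. [folklore] -/
private theorem eq_one_or_eq_of_finrank_eq_two (h2 : Module.finrank K L = 2) (hσ₀ : σ₀ ≠ 1)
    (σ : L ≃ₐ[K] L) : σ = 1 ∨ σ = σ₀ := by
  haveI : FiniteDimensional K L := Module.finite_of_finrank_eq_succ h2
  by_contra h
  rw [not_or] at h
  obtain ⟨h1, h2'⟩ := h
  have hcard : Fintype.card (L ≃ₐ[K] L) ≤ 2 :=
    (AlgEquiv.card_le : Fintype.card (L ≃ₐ[K] L) ≤ Module.finrank K L).trans h2.le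
  have h3 : Finset.card ({1, σ₀, σ} : Finset (L ≃ₐ[K] L)) = 3 := by
    rw [Finset.card_insert_of_notMem (by simp [Ne.symm hσ₀, Ne.symm h1]),
      Finset.card_insert_of_notMem (by simp [Ne.symm h2']), Finset.card_singleton]
  have := Finset.card_le_univ ({1, σ₀, σ} : Finset (L ≃ₐ[K] L))
  rw [h3] at this
  omega

omit [IsGalois K L] in
/-- **For `[L : K] = 2` and `σ₀ ≠ 1`, `Gal(L/K)`-invariance is `σ₀`-invariance** on `H¹(L, E_L[n])`
(`Aut(L/K) = {1, σ₀}`, `conjAct_one`) — the `Gal(K/ℚ) = ⟨1, τ⟩`-module bookkeeping of Gross 1991,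
§5 (5.1), over a general base. [cite: GrossLMS1991, §5 (5.1)] -/
theorem forall_conjAct_eq_iff_of_finrank_eq_two (h2 : Module.finrank K L = 2) (hσ₀ : σ₀ ≠ 1)
    (y : galH1Torsion (W.baseChange L) n) :
    (∀ σ : L ≃ₐ[K] L, conjAct W σ n y = y) ↔ conjAct W σ₀ n y = y := by
  refine ⟨fun h ↦ h σ₀, fun h σ ↦ ?_⟩
  rcases eq_one_or_eq_of_finrank_eq_two L σ₀ h2 hσ₀ σ with rfl | rfl
  · rw [conjAct_one, AddMonoidHom.id_apply]
  · exact h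

/-- **The kernel of `res : H¹(K, E[n]) → H¹(L, E_L[n])` is killed by `[L : K]`** for `L/K` finite
Galois (`index_nsmul_eq_zero_of_resTorsion_eq_zero` with `(Γ_K : galRange L) = [L : K]`,
`RelModel.index_galRange`). Dokchitser–Dokchitser 2010, proof of Lemma 4.14 ("kernel … killed by
`|G|`"). [cite: DokchitserDokchitserAnnals2010, Lemma 4.14 (proof)]
[cite: SerreGaloisCohomology1997, I.§2.4 Prop. 9] -/
theorem finrank_nsmul_eq_zero_of_resTorsion_eq_zero {x : galH1Torsion W n}
    (hx : resTorsion W L n x = 0) : Module.finrank K L • x = 0 := by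
  rw [← RelModel.index_galRange (K := K) L]
  exact index_nsmul_eq_zero_of_resTorsion_eq_zero L W n hx

/-- **A `Gal(L/K)`-invariant class of `H¹(L, E_L[n])` is, after multiplication by `[L : K]`, a
restriction**: for `y` with `σ · y = y` for all `σ ∈ Gal(L/K)` there is `x ∈ H¹(K, E[n])` with
`res x = [L : K] • y`. In the subgroup model `y` is fixed by the conjugation of every transported lift
`c_σ`, hence by all of `Γ_K = ⋃_σ c_σ · galRange L` (`RelModel.exists_liftToAbsGal_inv_mul_mem_galRange`,
`conjH1_mul_of_mem`), and `res (cor y) = (Γ_K : galRange L) y` (`exists_resSubgroupH1_eq_index_nsmul_of_forall_conjH1_eq`).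
Dokchitser–Dokchitser 2010, proof of Lemma 4.14 ("cokernel … killed by `|G|`").
[cite: DokchitserDokchitserAnnals2010, Lemma 4.14 (proof)] [cite: SerreGaloisCohomology1997, I.§2.4 (res, cor)] -/
theorem exists_resTorsion_eq_finrank_nsmul_of_forall_conjAct_eq {y : galH1Torsion (W.baseChange L) n}
    (hy : ∀ σ : L ≃ₐ[K] L, conjAct W σ n y = y) :
    ∃ x : galH1Torsion W n, resTorsion W L n x = Module.finrank K L • y := by
  haveI := RelModel.normal_galRange (K := K) L
  haveI := RelModel.finiteIndex_galRange (K := K) L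
  set y' := modelIsoTorsion L W n y with hy'
  have hfix : ∀ σ : L ≃ₐ[K] L,
      conjH1 (galRange (K := K) L) (geomTorsion W n) (liftToAbsGal (K := K) L σ) y' = y' := fun σ ↦ by
    rw [hy', ← modelIsoTorsion_conjAct L W n σ, hy σ]
  have hall : ∀ g : Field.absoluteGaloisGroup K,
      conjH1 (galRange (K := K) L) (geomTorsion W n) g y' = y' := fun g ↦ by
    obtain ⟨σ, hσ⟩ := RelModel.exists_liftToAbsGal_inv_mul_mem_galRange (K := K) L g
    have hg : g = liftToAbsGal (K := K) L σ * ((liftToAbsGal (K := K) L σ)⁻¹ * g) := by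
      rw [mul_inv_cancel_left]
    rw [hg, conjH1_mul_of_mem (galRange (K := K) L) _ hσ, hfix σ]
  obtain ⟨x, hx⟩ := exists_resSubgroupH1_eq_index_nsmul_of_forall_conjH1_eq (galRange (K := K) L)
    (isOpen_galRange L) hall
  refine ⟨x, (modelIsoTorsion L W n).injective ?_⟩
  rw [modelIsoTorsion_resTorsion, hx, RelModel.index_galRange (K := K) L, map_nsmul]

/-- **Inflation–restriction at finite level: `res : H¹(K, E[n]) → H¹(L, E_L[n])` is injective when
`E[n]^{Γ_L} = 0`** (`L/K` finite Galois, no non-zero point of `E[n] ⊆ E(K̄)` fixed by `galRange L` —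
i.e. `E_L[n](L) = 0`): the kernel of `res` is inflated from crossed homomorphisms vanishing on the
normal open subgroup `galRange L` (`resKer_le_range_inflClass`), and these vanish
(`inflClass_eq_zero_of_fixedPoints_eq_bot`). Serre, *Galois Cohomology*, I.§2.6 (b); the sharp form of
"kernel killed by `|G|`" in Dokchitser–Dokchitser 2010, Lemma 4.14 when `E(F)[pⁿ] = 0`.
[cite: SerreGaloisCohomology1997, I.§2.6 (b)] [cite: DokchitserDokchitserAnnals2010, Lemma 4.14 (proof)] -/
theorem resTorsion_injective_of_fixedPoints_eq_bot
    (hfix : FixedPoints.addSubgroup (galRange (K := K) L) (geomTorsion W n) = ⊥) :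
    Function.Injective (resTorsion W L n) := by
  haveI := RelModel.normal_galRange (K := K) L
  refine (injective_iff_map_eq_zero _).mpr fun x hx ↦ ?_
  have hmem : x ∈ resKer (resGal (K := K) L) (torsionBaseChangeMap W L n)
      (torsionBaseChangeMap_smul W L n) := by
    rw [resKer_eq_ker, AddMonoidHom.mem_ker]
    exact hx
  obtain ⟨f, hf⟩ := resKer_le_range_inflClass (resGal (K := K) L) (torsionBaseChangeMap W L n)
    (torsionBaseChangeMap_smul W L n) (torsionBaseChangeMap_bijective L W n) (galRange (K := K) L)
    (isOpen_galRange L) le_rfl hmem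
  rw [← hf, inflClass_eq_zero_of_fixedPoints_eq_bot (galRange (K := K) L) (isOpen_galRange L) hfix]

/-- **`res : H¹(K, E[n]) ≅ [L : K]`-saturated part of `H¹(L, E_L[n])^{Gal(L/K)}`, packaged**: when
`E[n]^{Γ_L} = 0`, `res` is injective, lands in the `Gal(L/K)`-invariants, and `[L : K]` times every
invariant class is in its image. [cite: DokchitserDokchitserAnnals2010, Lemma 4.14 (proof)] -/
theorem resTorsion_injective_and_invariant_of_fixedPoints_eq_bot
    (hfix : FixedPoints.addSubgroup (galRange (K := K) L) (geomTorsion W n) = ⊥) :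
    Function.Injective (resTorsion W L n) ∧
      (∀ (σ : L ≃ₐ[K] L) (x : galH1Torsion W n), conjAct W σ n (resTorsion W L n x) = resTorsion W L n x) ∧
      ∀ y : galH1Torsion (W.baseChange L) n, (∀ σ : L ≃ₐ[K] L, conjAct W σ n y = y) →
        ∃ x : galH1Torsion W n, resTorsion W L n x = Module.finrank K L • y :=
  ⟨resTorsion_injective_of_fixedPoints_eq_bot L W n hfix, fun σ x ↦ conjAct_resTorsion L W n σ x,
    fun _ hy ↦ exists_resTorsion_eq_finrank_nsmul_of_forall_conjAct_eq L W n hy⟩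

end Action

end RelModel

end Literature.NumberTheory.EllipticCurves
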